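import Summits.NavierStokesRegularity.FluidComputer.PalasekTowerClayBridge
import Literature.Analysis.FluidPDE.TaoForcedUniquenessHolds

/-!
# The E–C bridge's uniqueness hypothesis `hU` is a THEOREM

`Summits/NavierStokesRegularity/FluidComputer/` support file (cell `pub/ns-blowup`, seat `ns-blowup-lean`
g5). The FluidComputer vocabulary of the E–C endpoint (`PalasekTowerClayBridge.lean` and its ≈ 17
descendants: `Realisation.eq_of_claySolution`, `navierStokesBreakdownR3_of_step2`, the register closers
`…_of_episodes*`, `ClayBreakdownWitness.*`, `TriggeredTransferWitness.navierStokesBreakdownR3_of_transfers`,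
…) carries Tao's forced unconditional uniqueness as the HYPOTHESIS
`(hU : tao_unconditional_uniqueness_velocity_forced)` (Tao 2011, Cor. 11.4 = arXiv Cor. 71 WITH force,
velocity form, Clay-class force). That hypothesis is now discharged BY NAME:

* `tao_unconditional_uniqueness_velocity_forced_holds : tao_unconditional_uniqueness_velocity_forced` —
  from the Literature THEOREM `Literature.Analysis.FluidPDE.tao2011_forced_unconditionalUniqueness_velocity_holds`
  (Cor. 11.4 WITH force in Tao's general smooth `L^∞_t H¹_x` force class, `TaoForcedUniquenessHolds.lean`)
  through the tree's Clay-class specialisation `tao2011_forced_unconditionalUniqueness_velocity.schwartzForce`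
  (equivalently: lean2's `tao2011_forced_unconditionalUniqueness_velocity_schwartzForce_holds`,
  `TaoForcedBoundedTotalSpeed.lean`, which has verbatim this type).

So every `hU`-conditional statement of the E–C vocabulary holds with `hU := tao_unconditional_uniqueness_velocity_forced_holds`;
no statement of a landed file is restated here (the W14-free closers of record remain PATH B′,
`navierStokesBreakdownR3_of_step2_B`, and the `_B` family). WHAT THIS IS NOT: not NS — a uniqueness theorem
for forced smooth finite-energy solutions; no crux (`PalasekStep2`, `EpisodeBase`, `EpisodeInduction`,
`TriggerScheme.Transfers`) is touched.
-/

namespace Summit.NavierStokesRegularity.FluidComputer.PalasekTowerClayBridge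

/-- **Tao 2011, Cor. 11.4 (arXiv Cor. 71) WITH a Clay-class force, velocity form — the E–C bridge's
hypothesis `hU` — is a theorem**: `ν > 0`, `0 < T`, datum `u₀` with `u₀, ∇u₀ ∈ L²`, force smooth on
`[0, ∞) × ℝ³` with Fefferman's decay (5), two classical solutions of the forced system on `[0,T] × ℝ³`
from `u₀` with finite energy ⇒ they agree on `[0,T]`. The general forced Cor. 11.4
(`tao2011_forced_unconditionalUniqueness_velocity_holds`) specialised by the tree's `.schwartzForce`.
[cite: Tao2011, Cor. 11.4 (arXiv Cor. 71), p. 36] -/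
theorem tao_unconditional_uniqueness_velocity_forced_holds : tao_unconditional_uniqueness_velocity_forced :=
  Literature.Analysis.FluidPDE.tao2011_forced_unconditionalUniqueness_velocity_holds.schwartzForce

end Summit.NavierStokesRegularity.FluidComputer.PalasekTowerClayBridge
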